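import Summits.ResolutionOfSingularities.ResolutionOfSingularities.Theorems.FrobeniusLadderFRationalResolutionSingBlowupEntry
import Summits.ResolutionOfSingularities.ResolutionOfSingularities.Theorems.FrobeniusLadderFRationalResolutionRayRegular
import Summits.ResolutionOfSingularities.ResolutionOfSingularities.Theorems.FrobeniusLadderFRationalResolutionFixedStratumBaseSingular
import Summits.ResolutionOfSingularities.ResolutionOfSingularities.Theorems.FrobeniusLadderFRationalResolutionConeChartEntry
import Summits.ResolutionOfSingularities.ResolutionOfSingularities.Theorems.SectionAscentAffineToGlobalAffineSingularLocus
import HarnessLib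

/-!
# Crux `FrobeniusLadder.FRationalResolution` (stmt-ResolutionOfSingularities-15317), line `redirect`,
# stub `stub_diagonalizableQuotientResolution` — **ENTRY of design C3 from log regularity alone: varieties whose
# singular points carry sharp rank-two Kato-log-regular charts are resolved by iterating `Bl_{𝓘_{Sing}}`** (the rank-2
# stratum layer of the non-isolated case, over every field, in every dimension; `…SingBlowupEntry` with its pointwise
# singular-locus hypothesis DERIVED)

**`hasResolution_of_rank_two_logRegular_charts`.** Let `X` be integral, locally of finite type over a field `k`, and
suppose every SINGULAR point `x` has an étale roof `X ←ρ— Y —j↪ Spec A` into a Noetherian ring with an fs chart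
`φ : P → A`, `P ⊆ ℤ²` a cone in normal form `{m u + l e : l ≥ 0, a l ≤ d m}`, `a < d ≤ D`, all non-trivial monomials in
`𝔭 = j y` (`ρ y = x`), and `φ` Kato-log-regular at every prime below a point of the roof. Then `X` has a resolution of
singularities (the iterated blowing up of the reduced singular locus). The singular locus on the roof is computed here:
it IS the fixed stratum `V(I(𝔭, φ))` — «⊇» by `…FixedStratumBaseSingular` (singularity propagates along the stratum from
the singular point `𝔭`), «⊆» by RAY REGULARITY `…RayRegular.isRegularLocalRing_of_monomial_unit` (off the stratum some
monomial is a unit and the localised monoid is orthant-like).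

Honest label: assembly toward ONE leaf stub (no stub, crux or summit closed); still NOT the stub: the charts are
hypotheses, not produced from `hq` (that is the chart normalisation of lineages 2/4 + `…FixedStratumEntry`, with a
uniform `D` by quasi-compactness), and strata of sharp rank `≥ 3` are untouched. No definitions, no named facts, no
sorry. [cite: Kato1994, Def. (2.1), (7.3), (10.1), (10.3), (10.4)] [cite: KempfEtAl1973, Ch. I §1–§2]
[cite: Liu2002, §8.3.4, (3.11)]
-/

noncomputable section

-- single-problem summit: the doubled namespace component is forced
set_option linter.dupNamespace false

open CategoryTheory CategoryTheory.Limits AlgebraicGeometry TopologicalSpace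
open IsLocalRing Literature.AlgebraicGeometry.Resolution Literature.AlgebraicGeometry.Resolution.LogChart
open Summit.ResolutionOfSingularities.ResolutionOfSingularities.Theorems.FRationalResolution

namespace Summit.ResolutionOfSingularities.ResolutionOfSingularities.Theorems.FRationalResolution.SingBlowupEntryLogRegular

set_option maxHeartbeats 800000 in
/-- **Varieties with sharp rank-two Kato-log-regular charts at their singular points (strata of any dimension, any
field) are resolved by iterating the blowing up of the reduced singular locus.** See the module docstring.
[cite: Kato1994, Def. (2.1), (7.3), (10.1), (10.3), (10.4)] [cite: KempfEtAl1973, Ch. I §1–§2] -/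
theorem hasResolution_of_rank_two_logRegular_charts (D : ℕ) {k : Type} [Field k] (X : Scheme.{0}) [IsIntegral X]
    (f : X ⟶ Spec (.of k)) [LocallyOfFiniteType f]
    (H : ∀ x : X, x ∉ Scheme.regularLocus X →
      ∃ (A : Type) (_ : CommRing A) (_ : IsNoetherianRing A) (P : AddSubmonoid (Fin 2 → ℤ))
          (φ : Multiplicative P →* A) (𝔭 : Ideal A) (_ : 𝔭.IsPrime) (u e : Fin 2 → ℤ) (a d : ℕ),
          a < d ∧ d ≤ D ∧ P.FG ∧
          (∀ (w : Fin 2 → ℤ) (k : ℕ), 0 < k → k • w ∈ P → w ∈ P) ∧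
          Submodule.span ℤ (P : Set (Fin 2 → ℤ)) = ⊤ ∧
          (∀ p : P, (p : Fin 2 → ℤ) ≠ 0 → φ (Multiplicative.ofAdd p) ∈ 𝔭) ∧
          (∀ w, w ∈ P ↔ ∃ g ∈ Submodule.span ℤ (faceMonoid P φ 𝔭 : Set (Fin 2 → ℤ)), ∃ m l : ℤ,
            0 ≤ l ∧ (a : ℤ) * l ≤ (d : ℤ) * m ∧ w = g + m • u + l • e) ∧
          (∀ g ∈ Submodule.span ℤ (faceMonoid P φ 𝔭 : Set (Fin 2 → ℤ)), ∀ m l : ℤ,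
            g + m • u + l • e = 0 → m = 0 ∧ l = 0) ∧
          (∀ w : Fin 2 → ℤ, ∃ g ∈ Submodule.span ℤ (faceMonoid P φ 𝔭 : Set (Fin 2 → ℤ)),
            ∃ m l : ℤ, w = g + m • u + l • e) ∧
          ∃ (Y : Scheme.{0}) (ρ : Y ⟶ X) (_ : Etale ρ) (j : Y ⟶ Spec (.of A)) (_ : IsOpenImmersion j) (y : Y),
            ρ y = x ∧ (j y).asIdeal = 𝔭 ∧
            (∀ (y' : Y) (𝔮 : Ideal A) [𝔮.IsPrime], 𝔮 ≤ (j y').asIdeal → IsLogRegularAt P φ 𝔮)) :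
    Scheme.HasResolution X := by
  haveI : IsLocallyNoetherian X := LocallyOfFiniteType.isLocallyNoetherian f
  refine SingBlowupEntry.hasResolution_of_rank_two_charts D X f fun x hx => ?_
  obtain ⟨A, _, _, P, φ, 𝔭, _, u, e, a, d, had, hdD, hP, hsat, hspanP, hface, hQ, hind, hspan, Y, ρ, _, j, _, y,
    hρy, hjy, hregY⟩ := H x hx
  have hreg : IsLogRegularAt P φ 𝔭 := hregY y 𝔭 (by rw [hjy])
  -- the point `𝔭` is singular: transport along the roof
  haveI : IsLocallyNoetherian Y := LocallyOfFiniteType.isLocallyNoetherian (ρ ≫ f)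
  have hsing𝔭 : ¬ IsRegularLocalRing (Localization.AtPrime 𝔭) := by
    intro hr
    apply hx
    rw [← hρy, Scheme.mem_regularLocus, ← isRegularLocalRing_stalk_iff_of_etale ρ y]
    have h1 := mem_regularLocus_iff_of_flat_of_isPreimmersion j y
    simp only [Scheme.mem_regularLocus] at h1
    rw [h1, Summit.ResolutionOfSingularities.ResolutionOfSingularities.Theorems.AffineToGlobal.AffineSingularLocus.isRegularLocalRing_stalk_Spec_iff]
    have gen : ∀ (I : Ideal A) [I.IsPrime], I = 𝔭 → IsRegularLocalRing (Localization.AtPrime I) := by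
      rintro I _ rfl; exact hr
    exact gen _ hjy
  -- the pointwise description of the singular locus on the roof
  have hSing : ∀ y' : Y, ¬ IsRegularLocalRing (Localization.AtPrime (j y').asIdeal) ↔ ideal P φ 𝔭 ≤ (j y').asIdeal := by
    intro y'
    constructor
    · intro hs
      by_contra hI
      apply hs
      -- some monomial of `I(𝔭, φ)` is a unit at `j y'`
      obtain ⟨t, ht, ht'⟩ : ∃ t ∈ {t : A | ∃ p : P, φ (Multiplicative.ofAdd p) ∈ 𝔭 ∧ φ (Multiplicative.ofAdd p) = t},
          t ∉ (j y').asIdeal := by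
        by_contra hall
        push Not at hall
        apply hI
        rw [ideal]
        refine Ideal.span_le.2 ?_
        rintro _ ⟨p, hp, rfl⟩
        exact hall _ ⟨p, hp, rfl⟩
      obtain ⟨p, hp𝔭, rfl⟩ := ht
      have hpL : (p : Fin 2 → ℤ) ∉ Submodule.span ℤ (faceMonoid P φ 𝔭 : Set (Fin 2 → ℤ)) := by
        intro hmem
        have hp0 : (p : Fin 2 → ℤ) = 0 := ConeChartEntry.span_faceMonoid_eq_bot hface _ hmem
        have : φ (Multiplicative.ofAdd p) = 1 := by
          have hp' : p = 0 := Subtype.ext hp0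
          rw [hp', ofAdd_zero, map_one]
        rw [this] at hp𝔭
        exact (Ideal.IsPrime.ne_top inferInstance) (Ideal.eq_top_of_isUnit_mem _ hp𝔭 isUnit_one)
      exact RayRegular.isRegularLocalRing_of_monomial_unit hP hsat hspanP (by omega) hQ hind hspan (j y').asIdeal
        (hregY y' _ le_rfl) p hpL ht'
    · intro hI
      exact FixedStratumBaseSingular.not_isRegularLocalRing_of_stratum_of_face_zero hP hsat hspanP hI hface hreg
        (hregY y' _ le_rfl) hsing𝔭
  exact ⟨A, inferInstance, inferInstance, P, φ, 𝔭, inferInstance, u, e, a, d, had, hdD, hP, hsat, hspanP, hface, hQ,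
    hind, hspan, Y, ρ, inferInstance, j, inferInstance, y, hρy, hjy, hSing, hregY⟩

end Summit.ResolutionOfSingularities.ResolutionOfSingularities.Theorems.FRationalResolution.SingBlowupEntryLogRegular

end
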